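import Mathlib
import HarnessLib
import Literature.Geometry.Lorentzian.BackgroundChartCalculusFramed

/-!
# Route StarvedNecks — crux `FutureOrientedOfSeamed` (stmt-FinalStateConjecture-17576), line `Sketch`:
# stub `stub_oneSign`

One sign on a preconnected coordinate set for a VARIABLE continuous coordinate field, in the
subtype-chart form: for a smooth chart map `Ψ : B.domain → 𝓢` on the (open) domain of a model
background, a coordinate vector field `V` continuous on `B.domain`, and a preconnected `S ⊆ B.domain`
on which `dΨ_z(V z)` is causal, future-directedness at one point of `S` propagates to all of `S`.
This is `Spacetime.isFutureDirected_mfderiv_apply_of_isPreconnected` (BackgroundChartCalculusFramed)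
applied to the parametrisation `Ψ ∘ (chartAt E4 x₁).symm : E4 → 𝓢`, glued back to `Ψ` by
`Spacetime.contMDiffOn_comp_chartAt_symm` / `Spacetime.mfderiv_comp_chartAt_symm_apply`
(BackgroundChartCalculus).

Reference: B. O'Neill, *Semi-Riemannian geometry*, Academic Press 1983, Ch. 5, Lemma 5.26 ff., p. 145.
[folklore]
-/

noncomputable section

set_option linter.dupNamespace false
-- instance search through nested operator types `E4 →L[ℝ] E4 →L[ℝ] ℝ`
set_option maxSynthPendingDepth 3

open Set Filter Topology Function
open scoped Manifold ContDiff ENNReal Topology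
open Literature.Geometry.Lorentzian

namespace Summit.FinalStateConjecture.FinalStateConjecture.Theorems.FutureOrientedOfSeamed.ClockDualityRays

/-- **One sign on a preconnected coordinate set, variable field, subtype chart.** For a smooth
chart map `Ψ : B.domain → 𝓢` on the domain of a model background `B`, a coordinate vector field
`V` continuous on `B.domain`, and a preconnected `S ⊆ B.domain` on which `dΨ_z(V z)` is causal:
if `dΨ_{x₁}(V x₁)` is future-directed at one point `x₁ ∈ S` then `dΨ_x(V x)` is future-directed at
every `x ∈ S` (a continuous causal field on a connected set has one time-orientation: the pairing
with the reference timelike field is continuous and never vanishes, intermediate value theorem).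
Proof: `Spacetime.isFutureDirected_mfderiv_apply_of_isPreconnected` for the parametrisation
`Ψ ∘ (chartAt E4 x₁).symm`, whose differential at `z ∈ B.domain` is `dΨ_{⟨z, _⟩}`
(`Spacetime.mfderiv_comp_chartAt_symm_apply`). O'Neill 1983, *Semi-Riemannian geometry*, Ch. 5,
Lemma 5.26 ff., p. 145. [folklore] -/
theorem stub_oneSign (𝓢 : Spacetime.{0} 4) (B : ModelBackground) (Ψ : B.domain → 𝓢.carrier)
    (hΨ : ContMDiff 𝓘(ℝ, E4) (𝓡 4) ∞ Ψ) (V : E4 → E4) (hV : ContinuousOn V (B.domain : Set E4))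
    {S : Set E4} (hS : IsPreconnected S) (hSO : S ⊆ (B.domain : Set E4))
    (hc : ∀ z : B.domain, (z : E4) ∈ S → 𝓢.metric.IsCausal (mfderiv 𝓘(ℝ, E4) (𝓡 4) Ψ z (V z)))
    (x₁ : B.domain) (hx₁ : (x₁ : E4) ∈ S)
    (h₁ : 𝓢.timeOrientation.IsFutureDirected (mfderiv 𝓘(ℝ, E4) (𝓡 4) Ψ x₁ (V x₁)))
    (x : B.domain) (hx : (x : E4) ∈ S) :
    𝓢.timeOrientation.IsFutureDirected (mfderiv 𝓘(ℝ, E4) (𝓡 4) Ψ x (V x)) := by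
  -- adapted from `Literature.Geometry.Lorentzian.Spacetime.`
  -- `isFutureDirected_mfderiv_Ainv_basisVector_zero_of_norm_framedDeviation_lt_one`
  -- (BackgroundChartCalculusFramed) and from `isFutureDirected_mfderiv_of_segment`
  -- (Cruxes/FutureOrientedOfSeamed/LeverKitIdeator1): constant vector ↦ `V z`, segment ↦ `S`.
  set ψ : E4 → 𝓢.carrier := Ψ ∘ (chartAt E4 x₁).symm with hψdef
  have hψ : ContMDiffOn 𝓘(ℝ, E4) (𝓡 4) ∞ ψ B.domain := 𝓢.contMDiffOn_comp_chartAt_symm B Ψ x₁ hΨ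
  -- the differential of the parametrisation at `z ∈ B.domain` is `dΨ_{⟨z, hz⟩}`
  have hd : ∀ (z : E4) (hz : z ∈ (B.domain : Set E4)),
      mfderiv 𝓘(ℝ, E4) (𝓡 4) ψ z (V z) = mfderiv 𝓘(ℝ, E4) (𝓡 4) Ψ ⟨z, hz⟩ (V z) := fun z hz ↦
    𝓢.mfderiv_comp_chartAt_symm_apply B Ψ x₁ hz ((hΨ ⟨z, hz⟩).mdifferentiableAt (by simp)) _
  -- transport of future-directedness between `ψ` at `z` and `Ψ` at `⟨z, hz⟩`
  have hiff : ∀ (z : E4) (hz : z ∈ (B.domain : Set E4)),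
      𝓢.timeOrientation.IsFutureDirected (mfderiv 𝓘(ℝ, E4) (𝓡 4) ψ z (V z)) ↔
        𝓢.timeOrientation.IsFutureDirected (mfderiv 𝓘(ℝ, E4) (𝓡 4) Ψ ⟨z, hz⟩ (V z)) := by
    intro z hz
    have hp : (chartAt E4 x₁).symm z = ⟨z, hz⟩ := Subtype.ext (OpensChart.chartAt_symm_val x₁ hz)
    rw [hd z hz]
    show 𝓢.timeOrientation.IsFutureDirected (x := Ψ ((chartAt E4 x₁).symm z)) _ ↔ _
    rw [hp]
  -- transport of causality between `ψ` at `z` and `Ψ` at `⟨z, hz⟩`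
  have hiffc : ∀ (z : E4) (hz : z ∈ (B.domain : Set E4)),
      𝓢.metric.IsCausal (mfderiv 𝓘(ℝ, E4) (𝓡 4) ψ z (V z)) ↔
        𝓢.metric.IsCausal (mfderiv 𝓘(ℝ, E4) (𝓡 4) Ψ ⟨z, hz⟩ (V z)) := by
    intro z hz
    have hp : (chartAt E4 x₁).symm z = ⟨z, hz⟩ := Subtype.ext (OpensChart.chartAt_symm_val x₁ hz)
    rw [hd z hz]
    show 𝓢.metric.IsCausal (x := Ψ ((chartAt E4 x₁).symm z)) _ ↔ _
    rw [hp]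
  have hc' : ∀ z ∈ S, 𝓢.metric.IsCausal (mfderiv 𝓘(ℝ, E4) (𝓡 4) ψ z (V z)) :=
    fun z hz ↦ (hiffc z (hSO hz)).2 (hc ⟨z, hSO hz⟩ hz)
  have hx₁O : (x₁ : E4) ∈ (B.domain : Set E4) := x₁.2
  have hxO : (x : E4) ∈ (B.domain : Set E4) := x.2
  have key := 𝓢.isFutureDirected_mfderiv_apply_of_isPreconnected B.domain.2 hψ hS hSO V hV hc' hx₁
    ((hiff x₁ hx₁O).2 h₁) x hx
  exact (hiff x hxO).1 key

end Summit.FinalStateConjecture.FinalStateConjecture.Theorems.FutureOrientedOfSeamed.ClockDualityRays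

end
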